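import Literature.AlgebraicGeometry.HodgeTheory.ChernCharacterLawsTensorLine
import Literature.AlgebraicGeometry.HodgeTheory.ChernCharacterLawsSpanTopDegree
import Literature.AlgebraicGeometry.Motives.AmpleDivisorVeryAmpleMultiple
import Literature.AlgebraicGeometry.Modules.SerreTwistHyperplaneClass
import Literature.AlgebraicGeometry.HodgeTheory.AppellHumbertFormOfPhiPic
import HarnessLib

/-!
# `ch₁` of an ample line bundle is non-zero, for every lawful non-degenerate Chern datum

Family `hodge`, layer `Literature/AlgebraicGeometry/HodgeTheory`. HONEST FRAMING: nothing here constructs a Chern character or bears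
on any case of the Hodge conjecture; `ChernCharacterBetti` stays a hypothesis structure without an instance. Sequel to
`HodgeTheory/ChernCharacterLawsTensorLine` (tensor and dual laws for `ch₁` on line bundles, derived from the nine laws) and
`HodgeTheory/ChernCharacterLawsSpanTopDegree` (a non-degenerate datum sees the hyperplane class of a suitable projective embedding).
The tree has the same statement for the CHERN–WEIL class of a Hodge model (`HodgeTheory/AmpleDivisorChernClassNeZero`); here it is
proved for an ABSTRACT datum `ch` with the nine topological laws (`ChernDatum.IsTopological`) and `ch.NonDegenerate`:

* §1 `ch_serreTwist_one_ne_zero_of_isClosedImmersion` — **`ch₁(ι^*𝒪(-1)) ≠ 0` for EVERY closed immersion `ι : Y ↪ ℙᴺ` of a smooth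
  projective `Y` of dimension `≥ 1`**: re-embed by the Segre slice `ℙᴺ × {pt} ↪ ℙᴷ` (`K = Na + N + a`, `t_a(ch) ≠ 0`), along which `𝒪(-1)`
  pulls back to `𝒪(-1)` (`detClass_serreTwist_segre`); `ch₁(ι'^*𝒪(-1)) = ι'^* t_K` with `t_K` rational and non-zero, and a non-zero real
  multiple of `ι'^* t_K` is a KÄHLER class (`Deligne1982.exists_isKaehlerClass_smul_map_ι`), non-zero (`IsKaehlerClass.ne_zero`).
* §2 `exists_tensorPower` — iterated tensor powers `L^{⊗q}` of a rank-one module with `[det L^{⊗q}] = [det L]^q` and `ch₁(L^{⊗q}) = q • ch₁(L)`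
  (tensor law).
* §3 `ch_one_ne_zero_of_isAmple_of_laws` ∕ `ChernDatum.IsTopological.ch_one_ne_zero_of_isAmple` — **for an AMPLE Cartier divisor `Θ` on a
  smooth projective (integral) `Y` of dimension `≥ 1` and a rank-one module `L` of class `[𝒪_Y(Θ)]`, `ch₁(L) ≠ 0`** (the instance
  `[IsIntegral Y.left]`, needed to speak of Cartier divisors, is `IsSmoothProjective.isIntegral_holds`): `q • Θ ∼ H_ι` for a closed immersion
  `ι : Y ↪ ℙᴺ` (Hartshorne II Thm. 7.6, the tree's `CartierDivisor.IsAmple.exists_pos_smul_linEquiv_hyperplaneDivisor`), so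
  `L^{⊗q} ≅ (ι^*𝒪(-1))^∨` (`detClass_dual_serreTwist_eq`: `[𝒪_Y(m • H_ι)] = [(ι^*𝒪(-m))^∨]`; rank-one modules with equal classes are
  isomorphic, III Ex. 4.5) and `q • ch₁(L) = ch₁(L^{⊗q}) = −ch₁(ι^*𝒪(-1)) ≠ 0`; `…lineBundle…` — the instance for the line bundle
  `Modules.lineBundle Θ.toUnitCocycle` of the divisor.

This is Plan T step (T3), `p = 1`, universal part: with it, the divisor constant of every smooth projective curve is non-zero; the remaining
input of (NV)₁ («`ch₁(𝒪_X(Z)) ≠ 0` for every prime divisor `Z`») is the restriction to a curve on which `Z` is ample (memo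
MEMO-stub_spanForOne-hand-19780-g6 §2). Everything is proved; no definition, no named fact, no instance, no notation.

## References

* [Hartshorne1977] R. Hartshorne, Algebraic Geometry (1977): II Thm. 7.6, II Prop. 7.2, II Ex. 5.11–5.12, II Ex. 6.11, III Ex. 4.5.
* [Fulton1998] W. Fulton, Intersection Theory, 2nd ed. (1998): §15.1 (ii)–(iii), Example 3.2.3.
* [VoisinHodgeI2002] C. Voisin, Hodge Theory and Complex Algebraic Geometry I (2002): §3.1.3 Cor. 3.9, §3.3.2, Thm. 7.10.
* [GortzWedhorn2020] U. Görtz, T. Wedhorn, Algebraic Geometry I (2020): Thm. 13.59 (2), Prop. 11.21.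
* [Grothendieck1958] A. Grothendieck, La théorie des classes de Chern (1958): Thm. 1.
* Tree: `Motives/AmpleDivisorVeryAmpleMultiple`, `Modules/SerreTwistHyperplaneClass` (`detClass_dual_serreTwist_eq`), `Modules/DetClassTensor`,
  `HodgeTheory/ChernCharacterLawsTensorLine`, `HodgeTheory/ChernCharacterLawsSpanTopDegree`, `Deligne1982/SplitWeilTypeCMIsometry`.
-/

noncomputable section

open CategoryTheory CategoryTheory.Limits AlgebraicGeometry MonoidalCategory CartesianMonoidalCategory
open Literature.AlgebraicTopology.SingularHomology
open Literature.AlgebraicGeometry.Morphisms.ProjCech (PP)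
open Literature.AlgebraicGeometry.Modules.SerreTwist (serreTwist isFiniteLocallyFree_serreTwist hasRank_serreTwist
  detClass_serreTwist_comp detClass_serreTwist_segre detClass_dual_serreTwist_eq)
open Literature.AlgebraicGeometry.Motives

namespace Literature.AlgebraicGeometry.HodgeTheory

section HodgeTheory

variable (ch : ∀ (X : SchemeOver ℂ) (E : X.left.Modules) (i : ℕ), complexBetti X (2 * i))

/-! ### §1 `ch₁(ι^*𝒪(-1)) ≠ 0` for every projective embedding -/

/-- **`ch₁(ι^*𝒪_{ℙᴺ}(-1)) ≠ 0` for every closed immersion `ι : Y ↪ ℙᴺ` of a smooth projective `Y` of dimension `≥ 1`**, for a raw datum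
with isomorphism invariance, additivity, functoriality, `chᵢ(𝒪^I) = 0` (`i > 0`), rationality, and NON-DEGENERATE: re-embed `Y` through the
Segre slice `ℙᴺ × {pt} ↪ ℙᴺ × ℙᵃ ↪ ℙᴷ` with `t_a(ch) ≠ 0`; `ι'^*𝒪(-1) ≅ ι^*𝒪(-1)` (Segre product formula), `ch₁(ι'^*𝒪(-1)) = ι'^* t_K` with
`t_K` rational and non-zero, and `ι'^* t_K` has a Kähler non-zero real multiple. [cite: Hartshorne1977, II Ex. 5.11 and II Prop. 5.12 (b)–(c)]
[cite: VoisinHodgeI2002, §3.1.3 Cor. 3.9 and Thm. 7.10] [cite: Grothendieck1958, Thm. 1] -/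
theorem ch_serreTwist_one_ne_zero_of_isClosedImmersion
    (h_congr : ∀ {X : SchemeOver ℂ} {E F : X.left.Modules} (_ : E ≅ F) (i : ℕ), ch X E i = ch X F i)
    (h_shortExact : ∀ {X : SchemeOver ℂ} (S : ShortComplex X.left.Modules), S.ShortExact →
      IsVectorBundle S.X₁ → IsVectorBundle S.X₃ → ∀ i : ℕ, ch X S.X₂ i = ch X S.X₁ i + ch X S.X₃ i)
    (h_map : ∀ {X Y : SchemeOver ℂ} (f : Y ⟶ X) (E : X.left.Modules), IsVectorBundle E →
      ∀ i : ℕ, complexBetti.map f (2 * i) (ch X E i) = ch Y ((Scheme.Modules.pullback f.left).obj E) i)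
    (h_free : ∀ (X : SchemeOver ℂ) (I : Type) [Finite I] {i : ℕ}, 0 < i →
      ch X (SheafOfModules.free (R := X.left.ringCatSheaf) I) i = 0)
    (h_rat : ∀ (X : SchemeOver ℂ) (E : X.left.Modules), IsVectorBundle E → ∀ i : ℕ, IsRationalClass (ch X E i))
    (hnd : ∃ (N : ℕ) (L : (projectiveSpace N ℂ).left.Modules), HasRankLE L 1 ∧ ch (projectiveSpace N ℂ) L 1 ≠ 0)
    {n : ℕ} {Y : SchemeOver ℂ} (hY : IsSmoothProjective n Y) (hn : 1 ≤ n) {N : ℕ} (ι : Y ⟶ projectiveSpace N ℂ)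
    [IsClosedImmersion ι.left] :
    ch Y (serreTwist (ι.left : Y.left ⟶ PP ℂ N) 1) 1 ≠ 0 := by
  obtain ⟨m, rfl⟩ : ∃ m, n = m + 1 := ⟨n - 1, by omega⟩
  obtain ⟨a, -, hta⟩ := exists_ch_serreTwist_one_ne_zero_of_nonDegenerate ch h_congr h_shortExact h_map h_free hnd
  obtain ⟨P⟩ := (isSmoothProjective_projectiveSpace_holds ℂ a).nonempty_algPoints ℂ
  -- the Segre slice `ι' = (ι, const_P) ≫ σ : Y ↪ ℙᴷ`
  haveI := SegreHyperplaneClass.isSeparated_projectiveSpace_hom a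
  haveI : IsClosedImmersion (lift ι (toSpecOver Y ≫ P)).left := by
    have hc : (lift ι (toSpecOver Y ≫ P)).left ≫ (fst (projectiveSpace N ℂ) (projectiveSpace a ℂ)).left = ι.left := by
      rw [← Over.comp_left, lift_fst]
    haveI : IsSeparated (fst (projectiveSpace N ℂ) (projectiveSpace a ℂ)).left :=
      inferInstanceAs (IsSeparated (pullback.fst (projectiveSpace N ℂ).hom (projectiveSpace a ℂ).hom))
    haveI : IsClosedImmersion ((lift ι (toSpecOver Y ≫ P)).left ≫ (fst (projectiveSpace N ℂ) (projectiveSpace a ℂ)).left) := by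
      rw [hc]
      infer_instance
    exact IsClosedImmersion.of_comp _ (fst (projectiveSpace N ℂ) (projectiveSpace a ℂ)).left
  haveI : IsClosedImmersion (lift ι (toSpecOver Y ≫ P) ≫ segreEmbedding N a ℂ).left := by
    rw [Over.comp_left]
    infer_instance
  let e : ProjectiveEmbedding Y := ⟨N * a + N + a, lift ι (toSpecOver Y ≫ P) ≫ segreEmbedding N a ℂ, inferInstance⟩
  -- `t_K ≠ 0` by the other slice
  set tK := ch (projectiveSpace (N * a + N + a) ℂ)
    (serreTwist (𝟙 (projectiveSpace (N * a + N + a) ℂ).left :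
      (projectiveSpace (N * a + N + a) ℂ).left ⟶ PP ℂ (N * a + N + a)) 1) 1 with htK
  have htK0 : tK ≠ 0 := by
    obtain ⟨σ', hσ'⟩ := exists_segre_detClass_eq' N a
    intro h0
    apply hta
    rw [← map_ch_serreTwist_one_eq_of_detClass_eq ch h_congr h_map σ' hσ', ← htK, h0, map_zero]
  -- `ι'^*𝒪(-1) ≅ ι^*𝒪(-1)`: the Segre product formula with a constant second component
  have hcl : Modules.detClass (isFiniteLocallyFree_serreTwist (e.ι.left : Y.left ⟶ PP ℂ (N * a + N + a)) 1) =
      Modules.detClass (isFiniteLocallyFree_serreTwist (ι.left : Y.left ⟶ PP ℂ N) 1) := by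
    have h := detClass_serreTwist_segre (segreIndexEquiv N a) (lift ι (toSpecOver Y ≫ P)).left 1
    have h1 : (lift ι (toSpecOver Y ≫ P)).left ≫ pullback.fst (Segre.toSpec (Fin (N + 1)) ℂ) (Segre.toSpec (Fin (a + 1)) ℂ) =
        (ι.left : Y.left ⟶ PP ℂ N) := by
      change (lift ι (toSpecOver Y ≫ P) ≫ fst _ _).left = _
      rw [lift_fst]
    have h2 : (lift ι (toSpecOver Y ≫ P)).left ≫ pullback.snd (Segre.toSpec (Fin (N + 1)) ℂ) (Segre.toSpec (Fin (a + 1)) ℂ) =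
        ((toSpecOver Y ≫ P).left : Y.left ⟶ PP ℂ a) := by
      change (lift ι (toSpecOver Y ≫ P) ≫ snd _ _).left = _
      rw [lift_snd]
    refine h.trans ((congrArg₂ (· * ·) (detClass_serreTwist_congr h1 1) (detClass_serreTwist_congr h2 1)).trans ?_)
    rw [detClass_serreTwist_toSpecOver_comp, mul_one]
  obtain ⟨eM⟩ := (Modules.nonempty_iso_iff_detClass_eq (hasRank_serreTwist (e.ι.left : Y.left ⟶ PP ℂ (N * a + N + a)) 1)
    (hasRank_serreTwist (ι.left : Y.left ⟶ PP ℂ N) 1) (isFiniteLocallyFree_serreTwist _ 1) (isFiniteLocallyFree_serreTwist _ 1)).2 hcl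
  rw [← h_congr eM 1, ← map_ch_serreTwist_one_eq ch h_congr h_map e.ι, ← htK]
  -- Kähler: a non-zero real multiple of `ι'^* t_K` is a Kähler class, hence non-zero
  have hrat : IsRationalClass tK := h_rat _ _ (isFiniteLocallyFree_serreTwist _ 1).isVectorBundle 1
  obtain ⟨s, hs, hK⟩ := Deligne1982.exists_isKaehlerClass_smul_map_ι hY e hrat htK0
  have hne := hK.ne_zero hY (by omega)
  intro h0
  apply hne
  rw [h0, smul_zero]

/-! ### §2 Tensor powers of a rank-one module -/

/-- **Tensor powers**: for `L` of rank one on a smooth projective variety and `q ≥ 1` there is a rank-one module `M` («`L^{⊗q}`») with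
`[det M] = [det L]^q` and `ch₁(M) = q • ch₁(L)` (iterate the tensor law). [cite: Fulton1998, §15.1 (iii) and Example 3.2.3]
[cite: Hartshorne1977, II Ex. 6.11] -/
theorem exists_tensorPower
    (h_congr : ∀ {X : SchemeOver ℂ} {E F : X.left.Modules} (_ : E ≅ F) (i : ℕ), ch X E i = ch X F i)
    (h_map : ∀ {X Y : SchemeOver ℂ} (f : Y ⟶ X) (E : X.left.Modules), IsVectorBundle E →
      ∀ i : ℕ, complexBetti.map f (2 * i) (ch X E i) = ch Y ((Scheme.Modules.pullback f.left).obj E) i)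
    (h_free : ∀ (X : SchemeOver ℂ) (I : Type) [Finite I] {i : ℕ}, 0 < i →
      ch X (SheafOfModules.free (R := X.left.ringCatSheaf) I) i = 0)
    {n : ℕ} {X : SchemeOver ℂ} (hX : IsSmoothProjective n X) {L : X.left.Modules} (hL : HasRank L 1) (q : ℕ) (hq : 1 ≤ q) :
    ∃ (M : X.left.Modules) (hM : HasRank M 1),
      Modules.detClass (Modules.HasRank.isFiniteLocallyFree' hM) = Modules.detClass (Modules.HasRank.isFiniteLocallyFree' hL) ^ q ∧
        ch X M 1 = (q : ℂ) • ch X L 1 := by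
  induction q with
  | zero => exact absurd hq (by omega)
  | succ q ih =>
    rcases Nat.eq_zero_or_pos q with rfl | hq'
    · exact ⟨L, hL, by rw [zero_add, pow_one], by simp⟩
    · obtain ⟨M, hM, hdet, hch⟩ := ih hq'
      refine ⟨Modules.tensorObj M L, Modules.hasRank_tensorObj_one hM hL, ?_, ?_⟩
      · rw [Modules.detClass_tensorObj_of_hasRank_one hM hL (Modules.HasRank.isFiniteLocallyFree' hM)
          (Modules.HasRank.isFiniteLocallyFree' hL), hdet, pow_succ]
      · rw [ch_one_tensorObj_eq_add_of_laws ch h_congr h_map h_free hX hM hL, hch, Nat.cast_succ, add_smul, one_smul]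

/-! ### §3 `ch₁` of an ample line bundle is non-zero -/

/-- **`ch₁(𝒪_Y(Θ)) ≠ 0` for an AMPLE Cartier divisor `Θ` on a smooth projective `Y` of dimension `≥ 1`** (any rank-one module `L` with
`[det L] = [𝒪_Y(Θ)]`), for a raw datum with the laws of §1 and non-degenerate: `q • Θ ∼ H_ι` for a closed immersion `ι : Y ↪ ℙᴺ` and
`q ≥ 1` (II Thm. 7.6), so `L^{⊗q} ≅ (ι^*𝒪(-1))^∨` and `q • ch₁(L) = −ch₁(ι^*𝒪(-1)) ≠ 0`. [cite: Hartshorne1977, II Thm. 7.6 and III Ex. 4.5]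
[cite: GortzWedhorn2020, Thm. 13.59 (2) and Prop. 11.21] [cite: Fulton1998, §15.1 (iii)] -/
theorem ch_one_ne_zero_of_isAmple_of_laws
    (h_congr : ∀ {X : SchemeOver ℂ} {E F : X.left.Modules} (_ : E ≅ F) (i : ℕ), ch X E i = ch X F i)
    (h_shortExact : ∀ {X : SchemeOver ℂ} (S : ShortComplex X.left.Modules), S.ShortExact →
      IsVectorBundle S.X₁ → IsVectorBundle S.X₃ → ∀ i : ℕ, ch X S.X₂ i = ch X S.X₁ i + ch X S.X₃ i)
    (h_map : ∀ {X Y : SchemeOver ℂ} (f : Y ⟶ X) (E : X.left.Modules), IsVectorBundle E →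
      ∀ i : ℕ, complexBetti.map f (2 * i) (ch X E i) = ch Y ((Scheme.Modules.pullback f.left).obj E) i)
    (h_free : ∀ (X : SchemeOver ℂ) (I : Type) [Finite I] {i : ℕ}, 0 < i →
      ch X (SheafOfModules.free (R := X.left.ringCatSheaf) I) i = 0)
    (h_rat : ∀ (X : SchemeOver ℂ) (E : X.left.Modules), IsVectorBundle E → ∀ i : ℕ, IsRationalClass (ch X E i))
    (hnd : ∃ (N : ℕ) (L : (projectiveSpace N ℂ).left.Modules), HasRankLE L 1 ∧ ch (projectiveSpace N ℂ) L 1 ≠ 0)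
    {n : ℕ} {Y : SchemeOver ℂ} (hY : IsSmoothProjective n Y) (hn : 1 ≤ n) [IsIntegral Y.left] {Θ : CartierDivisor Y.left}
    (hΘ : Θ.IsAmple) {L : Y.left.Modules} (hL : HasRank L 1)
    (hcl : Modules.detClass (Modules.HasRank.isFiniteLocallyFree' hL) = Θ.cechClass) :
    ch Y L 1 ≠ 0 := by
  haveI : IsProper Y.hom := hY.isProjectiveOver.isProper
  obtain ⟨q, hq, N, ι, hι, a₀, ha₀, hlin⟩ := hΘ.exists_pos_smul_linEquiv_hyperplaneDivisor
  haveI := hι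
  obtain ⟨M, hM, hdet, hch⟩ := exists_tensorPower ch h_congr h_map h_free hY hL q hq
  -- `[det M] = [𝒪(q • Θ)] = [𝒪(H_ι)] = [(ι^*𝒪(-1))^∨]`
  have hqΘ : (q • Θ).cechClass = Θ.cechClass ^ q := CartierDivisor.cechClass_nsmul Θ q
  have hd := detClass_dual_serreTwist_eq ι.left 1 a₀ ha₀
  rw [CartierDivisor.one_smul] at hd
  have hMcl : Modules.detClass (Modules.HasRank.isFiniteLocallyFree' hM) =
      Modules.detClass (Modules.isFiniteLocallyFree_dual (isFiniteLocallyFree_serreTwist (ι.left : Y.left ⟶ PP ℂ N) 1)) := by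
    rw [hdet, hcl, ← hqΘ, hlin.cechClass_eq]
    exact hd.symm
  obtain ⟨eM⟩ := (Modules.nonempty_iso_iff_detClass_eq hM
    (Modules.hasRank_dual (hasRank_serreTwist (ι.left : Y.left ⟶ PP ℂ N) 1)) (Modules.HasRank.isFiniteLocallyFree' hM)
    (Modules.isFiniteLocallyFree_dual (isFiniteLocallyFree_serreTwist _ 1))).2 hMcl
  have hdual := ch_one_dual_eq_neg_of_laws ch h_congr h_map h_free hY (hasRank_serreTwist (ι.left : Y.left ⟶ PP ℂ N) 1)
  have hne := ch_serreTwist_one_ne_zero_of_isClosedImmersion ch h_congr h_shortExact h_map h_free h_rat hnd hY hn ι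
  -- `q • ch₁(L) = ch₁(M) = -ch₁(ι^*𝒪(-1)) ≠ 0`
  intro h0
  apply hne
  have h := hch
  rw [h_congr eM 1, hdual, h0, smul_zero, neg_eq_zero] at h
  exact h

/-- **Bundled form**: for a lawful non-degenerate datum, `ch₁(L) ≠ 0` for every rank-one module `L` of class `[𝒪_Y(Θ)]`, `Θ` ample on the
smooth projective `Y` of dimension `≥ 1`. [cite: Hartshorne1977, II Thm. 7.6] [cite: Fulton1998, §15.1 (iii)] -/
theorem ChernDatum.IsTopological.ch_one_ne_zero_of_isAmple {ch : ChernDatum} (h : ch.IsTopological) (hnd : ch.NonDegenerate)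
    {n : ℕ} {Y : SchemeOver ℂ} (hY : IsSmoothProjective n Y) (hn : 1 ≤ n) [IsIntegral Y.left] {Θ : CartierDivisor Y.left}
    (hΘ : Θ.IsAmple) {L : Y.left.Modules} (hL : HasRank L 1)
    (hcl : Modules.detClass (Modules.HasRank.isFiniteLocallyFree' hL) = Θ.cechClass) :
    ch Y L 1 ≠ 0 :=
  ch_one_ne_zero_of_isAmple_of_laws ch h.ch_congr h.ch_shortExact h.map_ch h.ch_free_of_pos h.isRationalClass_ch hnd hY hn hΘ hL hcl

/-- **The line bundle of an ample divisor**: `ch₁(𝒪_Y(Θ)) ≠ 0` for the module `Modules.lineBundle Θ.toUnitCocycle` (rank one, class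
`[𝒪_Y(Θ)]`). [cite: Hartshorne1977, II Thm. 7.6 and II Prop. 6.13] [cite: Fulton1998, §15.1 (iii)] -/
theorem ChernDatum.IsTopological.ch_one_lineBundle_ne_zero_of_isAmple {ch : ChernDatum} (h : ch.IsTopological)
    (hnd : ch.NonDegenerate) {n : ℕ} {Y : SchemeOver ℂ} (hY : IsSmoothProjective n Y) (hn : 1 ≤ n) [IsIntegral Y.left]
    {Θ : CartierDivisor Y.left} (hΘ : Θ.IsAmple) :
    ch Y (Modules.lineBundle Θ.toUnitCocycle) 1 ≠ 0 := by
  refine h.ch_one_ne_zero_of_isAmple hnd hY hn hΘ Θ.toUnitCocycle.hasRank_lineBundle ?_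
  rw [Modules.detClass_congr _ Θ.toUnitCocycle.isFiniteLocallyFree_lineBundle, Modules.UnitCocycle.detClass_lineBundle,
    CartierDivisor.cechClass_eq_mk]

end HodgeTheory

end Literature.AlgebraicGeometry.HodgeTheory

end
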